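import Summits.AtomisticToContinuum.HydrodynamicLimit.Theorems.AntiMazurCoboundariesKineticFluxLdDecayHTheoremObjects
import HarnessLib

/-!
# Objects of the crux line `h-theorem-dissipation-budget`, part B: the DENSITY CUT
# (crux `KineticFluxLdDecay`, stmt-AtomisticToContinuum-10967; lead a2, reshape 1)

Why a part B. The first form of the line's bet (`HTheorem.NoPerpetualDissipation`: the time-integrated Hellinger
production of the reduced one-body law is budgeted by the `N`-body entropy, for EVERY finite-entropy law) is FALSE
by an artefact of Boltzmann's production functional, which is quadratic in the one-body density AT A POINT: condition
`G_N` on one particle sitting in a ball of radius `ε = (N+1)^{-1}` with a non-Maxwellian velocity law `r` (cost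
`KL = 3 log(N+1) + O(1)`, so `s → 0`); the fibre density there is `1 + λ r`, `λ = 1/((N+1)|B_ε|) ≍ (N+1)²`, the
fibre production `≍ λ² D(r)`, and its time integral over the ballistic spreading time of the ball is `≍ D(r) = O(1)`,
against a budget `(N+1)^{-1/3}(A s + B) → 0` (lead a2, `Lines/h_theorem_dissipation_budget.md`; symmetric version: a
cold-started crystal with all particles localised to `δ ×` interparticle distance, excess `≍ δ^{-2}`). Real collisions
never see these "self pairs": the functional mis-measures dissipation exactly where the one-body POSITION density is
large on sub-interparticle scales — and such configurations carry almost no GAIN (`≤ κ ×` their mass) while their mass is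
budgeted by the position entropy. Hence the repair, which keeps the whole composition:

* `posDensity` — the position density `n_t = d(f_t)₁/dvol` of the reduced one-body law; `cutDensity K` — the one-body
  density with the fibres `{n_t > K}` zeroed (production is fibrewise in `x`, so cutting fibres is cutting production);
* `GainDominationLocal` — the kinetic lemma localised to a measurable set of fibres `E` (same weak-formulation proof as
  `GainDomination`, which is its case `E = univ`);
* `PositionTailBudget` — the mass of the high-density fibres is small: `(N+1)·(f_t)₁{n_t > K} ≤ 2(KL(ν‖G_N) + 2(N+1))/log K`
  (Donsker–Varadhan with position test functions, invariance, and the free-volume bound `Z_N ≥ e^{-2(N+1)}` for `σ ≤ 1/2`);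
* `NoPerpetualDissipationBdd` — the repaired bet `C⁺_K`: for every cut level `K ≥ 1` there are `A, B` (depending on
  `σ, a, θ, K`) budgeting the time-integrated production of the CUT density by `(h/τ)(A s + B)`.

The composition chooses `K = K(δ)` first (`2κ₁/log K ≤ δ/4`), then `A, B`, then `τ`.
-/

noncomputable section

open MeasureTheory ProbabilityTheory Set Filter InformationTheory
open scoped ENNReal

namespace Summit.AtomisticToContinuum.HydrodynamicLimit.Theorems.HTheorem

open Literature.MathematicalPhysics.KineticTheory (T3 V3 hsDiameter localGibbsLaw)
open Literature.Analysis.FluidPDE (HardSphereFlow Config)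

/-! ## The density cut -/

/-- The POSITION DENSITY of the reduced one-body law at time `t` (Radon–Nikodym derivative of its position
marginal w.r.t. the Haar probability measure of `𝕋³`; `≡ 1` at equilibrium). -/
def posDensity {ε : ℝ} {n : ℕ} (θ : ℝ) (u₀ : V3) (Φ : TFlow ε n) (ν : Measure (TPhase n)) (t : ℝ) :
    T3 → ℝ :=
  fun x => ((oneBodyLaw θ u₀ Φ ν t).fst.rnDeriv volume x).toReal

/-- The CUT ONE-BODY DENSITY at level `K`: the one-body density with the fibres over `{x | n_t(x) > K}` set to `0`
(those fibres then contribute no Hellinger production). Written as a `Set.indicator` of a product set so that it is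
literally the cut of `GainDominationLocal` for `E = {x | n_t(x) ≤ K}`. -/
def cutDensity {ε : ℝ} {n : ℕ} (K : ℝ) (θ : ℝ) (u₀ : V3) (Φ : TFlow ε n) (ν : Measure (TPhase n)) (t : ℝ) :
    T3 × V3 → ℝ :=
  Set.indicator ({x | posDensity θ u₀ Φ ν t x ≤ K} ×ˢ Set.univ)
    (fun y => ((oneBodyLaw θ u₀ Φ ν t).rnDeriv refMeasure y).toReal)

/-! ## Statements of the registered stubs of the reshaped skeleton -/

/-- Statement of `stub_gainDominationLocal` — **gain–dissipation duality, localised to a set of fibres**: as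
`GainDomination`, for the gain `∫ (1_E φ)(x) g(w) df` collected on a measurable set `E ⊆ 𝕋³` of positions, against the
production of the density cut to the fibres over `E`. Same proof (the weak-formulation argument is fibrewise in `x`;
integrate it over `E` only). `GainDomination` is the case `E = univ`. -/
def GainDominationLocal : Prop :=
  ∃ κ₁ : ℝ, 0 < κ₁ ∧ ∀ g : V3 → ℝ, Continuous g → (∀ w, |g w| ≤ κ₁) → Orthogonal g →
    ∃ C : ℝ, 0 ≤ C ∧ ∀ φ : T3 → ℝ, Measurable φ → (∀ x, |φ x| ≤ 1) →
      ∀ E : Set T3, MeasurableSet E →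
      ∀ f : Measure (T3 × V3), IsProbabilityMeasure f → f ≪ refMeasure → velKL f ≠ ⊤ →
        ∀ d : ℝ, 0 ≤ d →
          production (Set.indicator (E ×ˢ Set.univ) (fun y => (f.rnDeriv refMeasure y).toReal)) ≤
            ENNReal.ofReal d →
          ∫ y, Set.indicator E φ y.1 * g y.2 ∂f ≤ C * Real.sqrt d + 2⁻¹ * (velKL f).toReal

/-- Statement of `stub_positionTailBudget` — **the high-density fibres carry little mass**: in the crux frame
(`a, θ > 0`, `σ ≤ 1/2`), for a probability law `ν ≪ G_N` of finite relative entropy, every time `t` and every cut level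
`K ≥ e²`, `(N+1) · (f_t)₁{x | n_t(x) > K} ≤ 2 (KL(ν‖G_N) + 2(N+1)) / log K`.
Proof plan: Donsker–Varadhan `E_ν Y ≤ KL(ν‖G) + log E_G e^Y` with `Y = Σᵢ ψ(xᵢ(t))`, `ψ = log K · 1_A − log Z_ψ`,
`A = {n_t > K}`, `Z_ψ = ∫ e^{log K · 1_A} dvol ≤ 1 + (K−1) vol A ≤ 1 + m (K−1)/K` (`vol A ≤ m/K`, `m = (f_t)₁ A`);
invariance of `G_N`; `E_G e^{Σ ψ(xᵢ)} ≤ (∫ e^ψ)^{N+1}/Z_N ≤ 1/Z_N` with the free-volume (sequential insertion) bound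
`log(1/Z_N) ≤ −(N+1) log(1 − (4π/3)σ³) ≤ 2(N+1)` for `σ ≤ 1/2`; `E_ν Y = (N+1)(m log K − log Z_ψ) ≥ (N+1)(m log K − m)`;
rearrange with `log K − 1 ≥ (log K)/2`. -/
def PositionTailBudget : Prop :=
  ∀ (σ a θ : ℝ) (u₀ : V3) (N : ℕ) (Φ : Flow σ N) (ν : Measure (Phase N)), IsProbabilityMeasure ν →
    0 < a → 0 < θ → 0 < σ → σ ≤ 1 / 2 →
    ν ≪ gibbs σ a θ u₀ N Φ → klDiv ν (gibbs σ a θ u₀ N Φ) ≠ ⊤ → ∀ (t K : ℝ), Real.exp 2 ≤ K →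
      ((N + 1 : ℕ) : ℝ) *
          ((oneBodyLaw θ u₀ Φ ν t).fst {x | K < posDensity θ u₀ Φ ν t x}).toReal ≤
        2 * ((klDiv ν (gibbs σ a θ u₀ N Φ)).toReal + 2 * ((N + 1 : ℕ) : ℝ)) / Real.log K

/-- Statement of `stub_noPerpetualDissipationBdd` — **`C⁺_K` = NO PERPETUAL DISSIPATION BELOW A DENSITY CUT (the bet,
repaired; the one deterministic, `N`-uniform stub of the line).** For constant profiles `(a, θ, u₀)`, small reduced density
`σ < σ₀` and every cut level `K ≥ 1` there are constants `A, B ≥ 0` such that for every kinetic window `τ`, all large `N`,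
every flow and every initial probability law `ν ≪ G_N` of finite relative entropy, the time-integrated Hellinger
production of the CUT one-body density (fibres with position density `> K` removed) over the window `h = τ(N+1)^{-1/3}` is
budgeted by the entropy per particle: `∫₀ʰ 𝒟(ρ_t^{ν} 1_{n_t ≤ K}) dt ≤ (h/τ)(A·KL(ν‖G_N)/(N+1) + B)`.
True along the Boltzmann flow (H-theorem, `A = 1/(σ²√θ)`, `B = O(σ)` for the hard-core entropy); its negation is a
perpetual anti-dissipation machine of bounded density at fixed specific entropy. The cut removes the point-density
artefact that refutes the uncut form. -/
def NoPerpetualDissipationBdd : Prop :=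
  ∀ (a θ : ℝ) (u₀ : V3), 0 < a → 0 < θ → ∃ σ₀ : ℝ, 0 < σ₀ ∧ ∀ σ : ℝ, 0 < σ → σ < σ₀ →
    ∀ K : ℝ, 1 ≤ K → ∃ A B : ℝ, 0 ≤ A ∧ 0 ≤ B ∧ ∀ τ : ℝ, 0 < τ → ∃ N₀ : ℕ, ∀ N : ℕ, N₀ ≤ N →
      ∀ (Φ : Flow σ N) (ν : Measure (Phase N)), IsProbabilityMeasure ν →
        ν ≪ gibbs σ a θ u₀ N Φ → klDiv ν (gibbs σ a θ u₀ N Φ) ≠ ⊤ →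
        ∫⁻ t in Set.Ioo 0 (window τ N), production (cutDensity K θ u₀ Φ ν t) ≤
          ENNReal.ofReal (window τ N / τ *
            (A * (klDiv ν (gibbs σ a θ u₀ N Φ)).toReal / ((N + 1 : ℕ) : ℝ) + B))

/-! ## Basic API -/

/-- The position density is measurable. -/
theorem measurable_posDensity {ε : ℝ} {n : ℕ} (θ : ℝ) (u₀ : V3) (Φ : TFlow ε n) (ν : Measure (TPhase n))
    (t : ℝ) : Measurable (posDensity θ u₀ Φ ν t) :=
  (Measure.measurable_rnDeriv _ _).ennreal_toReal

/-- The low-density set `{x | n_t(x) ≤ K}` is measurable. -/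
theorem measurableSet_posDensity_le {ε : ℝ} {n : ℕ} (θ : ℝ) (u₀ : V3) (Φ : TFlow ε n) (ν : Measure (TPhase n))
    (t K : ℝ) : MeasurableSet {x | posDensity θ u₀ Φ ν t x ≤ K} :=
  measurableSet_le (measurable_posDensity θ u₀ Φ ν t) measurable_const

/-- The cut density is literally the cut of `GainDominationLocal` at `E = {n_t ≤ K}` for the one-body law. -/
theorem cutDensity_eq {ε : ℝ} {n : ℕ} (K θ : ℝ) (u₀ : V3) (Φ : TFlow ε n) (ν : Measure (TPhase n)) (t : ℝ) :
    cutDensity K θ u₀ Φ ν t =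
      Set.indicator ({x | posDensity θ u₀ Φ ν t x ≤ K} ×ˢ Set.univ)
        (fun y => ((oneBodyLaw θ u₀ Φ ν t).rnDeriv refMeasure y).toReal) :=
  rfl

/-- Gain splitting at the cut: the gain collected on the high-density fibres is at most `κ ×` their mass. -/
theorem integral_indicator_compl_mul_le {f : Measure (T3 × V3)} [IsFiniteMeasure f] {φ : T3 → ℝ} {g : V3 → ℝ}
    {κ : ℝ} (hφ : ∀ x, |φ x| ≤ 1) (hg : ∀ w, |g w| ≤ κ) {E : Set T3} (hE : MeasurableSet E) :
    ∫ y, Set.indicator Eᶜ φ y.1 * g y.2 ∂f ≤ κ * (f.fst Eᶜ).toReal := by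
  have hκ : 0 ≤ κ := (abs_nonneg _).trans (hg 0)
  have hpt : ∀ y : T3 × V3,
      |Set.indicator Eᶜ φ y.1 * g y.2| ≤ Set.indicator (Eᶜ ×ˢ Set.univ) (fun _ => κ) y := by
    intro y
    by_cases hy : y.1 ∈ Eᶜ
    · have : y ∈ Eᶜ ×ˢ (Set.univ : Set V3) := ⟨hy, Set.mem_univ _⟩
      rw [Set.indicator_of_mem hy, Set.indicator_of_mem this, abs_mul]
      exact (mul_le_mul (hφ _) (hg _) (abs_nonneg _) zero_le_one).trans_eq (one_mul κ)
    · have : y ∉ Eᶜ ×ˢ (Set.univ : Set V3) := fun h => hy h.1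
      rw [Set.indicator_of_notMem hy, Set.indicator_of_notMem this, zero_mul, abs_zero]
  have hint : Integrable (Set.indicator (Eᶜ ×ˢ Set.univ) fun _ : T3 × V3 => κ) f :=
    (integrable_const κ).indicator (hE.compl.prod MeasurableSet.univ)
  calc ∫ y, Set.indicator Eᶜ φ y.1 * g y.2 ∂f
      ≤ ∫ y, |Set.indicator Eᶜ φ y.1 * g y.2| ∂f :=
        (le_abs_self _).trans (abs_integral_le_integral_abs (μ := f) (f := fun y => Set.indicator Eᶜ φ y.1 * g y.2))
    _ ≤ ∫ y, Set.indicator (Eᶜ ×ˢ Set.univ) (fun _ => κ) y ∂f :=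
        integral_mono_of_nonneg (ae_of_all _ fun _ => abs_nonneg _) hint (ae_of_all _ hpt)
    _ = κ * (f.fst Eᶜ).toReal := by
        rw [integral_indicator (hE.compl.prod MeasurableSet.univ), setIntegral_const, smul_eq_mul, mul_comm,
          Measure.fst_apply hE.compl, measureReal_def, Set.prod_univ]

/-! ### Bookkeeping sub-goal of part B -/

/-- Statement of the bookkeeping sub-goal `stub_hTheoremObjectsB` — part B's objects are what the composition needs
them to be: the low-density set is measurable, the cut density is the `GainDominationLocal` cut at that set, and the
gain on the complementary (high-density) fibres is at most `κ ×` their mass. -/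
def HTheoremObjectsBBasic : Prop :=
  (∀ (ε : ℝ) (n : ℕ) (θ : ℝ) (u₀ : V3) (Φ : TFlow ε n) (ν : Measure (TPhase n)) (t K : ℝ),
      MeasurableSet {x | posDensity θ u₀ Φ ν t x ≤ K}) ∧
    ∀ (f : Measure (T3 × V3)), IsFiniteMeasure f → ∀ (φ : T3 → ℝ) (g : V3 → ℝ) (κ : ℝ),
      (∀ x, |φ x| ≤ 1) → (∀ w, |g w| ≤ κ) → ∀ E : Set T3, MeasurableSet E →
        ∫ y, Set.indicator Eᶜ φ y.1 * g y.2 ∂f ≤ κ * (f.fst Eᶜ).toReal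

/-- **Bookkeeping sub-goal of part B** (`stub_hTheoremObjectsB`). -/
theorem stub_hTheoremObjectsB : HTheoremObjectsBBasic :=
  ⟨fun _ _ θ u₀ Φ ν t K => measurableSet_posDensity_le θ u₀ Φ ν t K,
    fun _ _ _ _ _ hφ hg _ hE => integral_indicator_compl_mul_le hφ hg hE⟩

end Summit.AtomisticToContinuum.HydrodynamicLimit.Theorems.HTheorem

end
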